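import Summits.HubbardSuperconductivity.HubbardSuperconductivity.Theorems.LiebTwinBondLocalityGlue
import HarnessLib

/-!
# Route `LiebTwin` — CYCLE-FREE glue for the REAL FLIP-DEFINITE restatement of the cruxes
# (crux `DWavePolarisedDiscordance`, stmt-HubbardSuperconductivity-15314; helper, `--supports`)

Typing advice of the crux census (`Cruxes/DWavePolarisedDiscordance/STRATEGY-CENSUS.md`, §Decomposition,
third split; lead c1 `Lines/registered.md`; refuter ATTACK remark (1)): restate K3′ as the bond-locality
form K3″ AND quantify K2/K3″ over REAL ground states with FLIP-DEFINITE Lieb matrix (`Wᵀ = ±W`) only —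
the class on which the discordance calculus holds (`Theorems/LiebTwinDWavePolarisedDiscordanceChannelBound.lean`)
— discharging the route's proved support `RealFlipDefiniteSuffices` inside the glue. This module provides
that glue, without importing `Theses.LiebTwin` (so the route file may import it):

* `uniformDWaveFloor_of_realBondLocality` — K2 over real flip-definite ground states at a box point,
  K3″ over real flip-definite ground states on the box, `NoOnsiteODLRO` (every ground state; shared crux
  stmt-0933) and the body of `RealFlipDefiniteSuffices` give the uniform floor `(κc/2)·L⁴ ≤ F_d(ψ)` for EVERY
  normalised sector ground state at the K2 point, eventually in even `L`;
* `hubbardSuperconductivity_of_realBondLocality` — hence the summit, through the proved shared support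
  `IntrinsicLargeN.uniformLROGivesSummitMatrix_proof`.

So a planner may set, after restating the two cruxes over real flip-definite ground states,
`closes hK2 hK3 hNo hRF := LiebTwinBondLocality.hubbardSuperconductivity_of_realBondLocality hK2 hK3 hNo hRF`
(`hNo` unfolded to the `EnslavedA1g` copy, `hRF : RealFlipDefiniteSuffices` unfolded). The every-ground-state
versions (rev 1 of the route) imply the real-flip-definite ones a fortiori, so nothing is lost.
Sources: E. H. Lieb, PRL **62** (1989) 1201, proof of Theorem 1 ("W Hermitian WLOG"); D. J. Scalapino, Phys.
Rep. **250** (1995) 329, §2. No definition, no named fact, no `sorry`.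
-/

noncomputable section

-- `dupNamespace`: the summit and the problem are both named `HubbardSuperconductivity` (layout D-0022)
set_option linter.dupNamespace false

namespace Summit.HubbardSuperconductivity.HubbardSuperconductivity.Theorems.LiebTwinBondLocality

open Matrix
open Literature.MathematicalPhysics.QuantumLattice
open scoped Matrix MatrixOrder Matrix.Norms.L2Operator ComplexOrder
open Summit.HubbardSuperconductivity.HubbardSuperconductivity.Theses.EnslavedA1g (NoOnsiteODLRO)

/-- **Uniform d-wave floor from the real-flip-definite forms of K2 and K3″** (plus `NoOnsiteODLRO` and the
body of `RealFlipDefiniteSuffices`): at the K2 point `(U, δ)`, `(κc/2)·L⁴ ≤ F_d(ψ)` for EVERY normalised sector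
ground state `ψ`, eventually in even `L`. For a real flip-definite ground state: `F_s(φ̃) ≥ cL⁴`,
`F_s(φ) ≤ (c/4)L⁴`, `F_xs(φ) ≤ (κc/8)L⁴`, K3″ at `ε = κc/8`; the reduction lemma extends the floor to all
ground states at each `(U, L, n)`. Lieb, PRL 62 (1989) 1201; Scalapino, Phys. Rep. 250 (1995) 329, §2. [folklore] -/
theorem uniformDWaveFloor_of_realBondLocality
    (hK2 : ∃ U ∈ Set.Ioc (0 : ℝ) 4, ∃ δ ∈ Set.Icc (1 / 10 : ℝ) (3 / 10), ∃ c : ℝ, 0 < c ∧ ∃ L₀ : ℕ,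
      ∀ (L : ℕ) [NeZero L], L₀ ≤ L → Even L → ∀ φ : Fock (Orb (FermionTorus 2 L)), star φ ⬝ᵥ φ = 1 →
        IsGroundStateInSector (hubbardTorus 2 L 1 U) (2 * ⌊(1 - δ) * (L : ℝ) ^ 2 / 2⌋₊) 0 φ →
          (∀ s, star (φ s) = φ s) →
            ((liebW ⌊(1 - δ) * (L : ℝ) ^ 2 / 2⌋₊ φ)ᵀ = liebW ⌊(1 - δ) * (L : ℝ) ^ 2 / 2⌋₊ φ ∨
              (liebW ⌊(1 - δ) * (L : ℝ) ^ 2 / 2⌋₊ φ)ᵀ = -liebW ⌊(1 - δ) * (L : ℝ) ^ 2 / 2⌋₊ φ) →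
            c * (L : ℝ) ^ 4 ≤ (expect ((pairField sWave L)ᴴ * pairField sWave L)
              (liebVec ⌊(1 - δ) * (L : ℝ) ^ 2 / 2⌋₊ (CFC.abs (liebW ⌊(1 - δ) * (L : ℝ) ^ 2 / 2⌋₊ φ)))).re)
    (hK3 : ∀ U ∈ Set.Ioc (0 : ℝ) 4, ∀ δ ∈ Set.Icc (1 / 10 : ℝ) (3 / 10), ∃ κ : ℝ, 0 < κ ∧ ∀ ε : ℝ, 0 < ε →
      ∃ L₀ : ℕ, ∀ (L : ℕ) [NeZero L], L₀ ≤ L → Even L → ∀ φ : Fock (Orb (FermionTorus 2 L)),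
        star φ ⬝ᵥ φ = 1 →
          IsGroundStateInSector (hubbardTorus 2 L 1 U) (2 * ⌊(1 - δ) * (L : ℝ) ^ 2 / 2⌋₊) 0 φ →
            (∀ s, star (φ s) = φ s) →
              ((liebW ⌊(1 - δ) * (L : ℝ) ^ 2 / 2⌋₊ φ)ᵀ = liebW ⌊(1 - δ) * (L : ℝ) ^ 2 / 2⌋₊ φ ∨
                (liebW ⌊(1 - δ) * (L : ℝ) ^ 2 / 2⌋₊ φ)ᵀ = -liebW ⌊(1 - δ) * (L : ℝ) ^ 2 / 2⌋₊ φ) →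
              κ * ((expect ((pairField sWave L)ᴴ * pairField sWave L)
                      (liebVec ⌊(1 - δ) * (L : ℝ) ^ 2 / 2⌋₊
                        (CFC.abs (liebW ⌊(1 - δ) * (L : ℝ) ^ 2 / 2⌋₊ φ)))).re -
                    (expect ((pairField sWave L)ᴴ * pairField sWave L) φ).re) -
                  ε * (L : ℝ) ^ 4 ≤
                (expect ((pairField dWaveFormFactor L)ᴴ * pairField dWaveFormFactor L) φ).re +
                  (expect ((pairField extendedSWave L)ᴴ * pairField extendedSWave L) φ).re)
    (hNo : NoOnsiteODLRO)
    (hRF : ∀ (U a : ℝ) (L : ℕ) [NeZero L] (n : ℕ),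
      (∀ φ : Fock (Orb (FermionTorus 2 L)), star φ ⬝ᵥ φ = 1 →
        IsGroundStateInSector (hubbardTorus 2 L 1 U) (2 * n) 0 φ → (∀ s, star (φ s) = φ s) →
          ((liebW n φ)ᵀ = liebW n φ ∨ (liebW n φ)ᵀ = -liebW n φ) →
            a ≤ (expect ((pairField dWaveFormFactor L)ᴴ * pairField dWaveFormFactor L) φ).re) →
        ∀ ψ : Fock (Orb (FermionTorus 2 L)), star ψ ⬝ᵥ ψ = 1 →
          IsGroundStateInSector (hubbardTorus 2 L 1 U) (2 * n) 0 ψ →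
            a ≤ (expect ((pairField dWaveFormFactor L)ᴴ * pairField dWaveFormFactor L) ψ).re) :
    ∃ U ∈ Set.Ioc (0 : ℝ) 4, ∃ δ ∈ Set.Icc (1 / 10 : ℝ) (3 / 10), ∃ a : ℝ, 0 < a ∧ ∃ L₀ : ℕ,
      ∀ (L : ℕ) [NeZero L], L₀ ≤ L → Even L → ∀ ψ : Fock (Orb (FermionTorus 2 L)),
        star ψ ⬝ᵥ ψ = 1 →
          IsGroundStateInSector (hubbardTorus 2 L 1 U) (2 * ⌊(1 - δ) * (L : ℝ) ^ 2 / 2⌋₊) 0 ψ →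
            a * (L : ℝ) ^ 4 ≤
              (expect ((pairField dWaveFormFactor L)ᴴ * pairField dWaveFormFactor L) ψ).re := by
  obtain ⟨U, hU, δ, hδ, c, hc, L₀, h2⟩ := hK2
  obtain ⟨κ, hκ, h3⟩ := hK3 U hU δ hδ
  obtain ⟨L₁, h3⟩ := h3 (κ * c / 8) (by positivity)
  obtain ⟨L₂, hs⟩ := uniformNoOnsite_of_noOnsiteODLRO hNo U hU δ hδ (c / 4) (by positivity)
  obtain ⟨L₃, hxs⟩ := extendedS_le_of_noOnsiteODLRO hNo U hU δ hδ (κ * c / 8) (by positivity)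
  refine ⟨U, hU, δ, hδ, κ * c / 2, by positivity, L₀ + L₁ + L₂ + L₃, fun L _ hL hE ψ hψ hgs => ?_⟩
  -- the floor for every REAL FLIP-DEFINITE ground state at this `(U, L, n)` ...
  refine hRF U (κ * c / 2 * (L : ℝ) ^ 4) L ⌊(1 - δ) * (L : ℝ) ^ 2 / 2⌋₊
    (fun φ hφ hgsφ hreal hflip => ?_) ψ hψ hgs
  -- ... from K2, K3″ (both at `φ`), the uniform no-on-site bound and the extended-`s` bound
  have i2 := h2 L (by omega) hE φ hφ hgsφ hreal hflip
  have i3 := h3 L (by omega) hE φ hφ hgsφ hreal hflip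
  have is := hs L (by omega) hE φ hφ hgsφ
  have ix := hxs L (by omega) hE φ hφ hgsφ
  have hL4 : (0 : ℝ) ≤ (L : ℝ) ^ 4 := by positivity
  have hκB := mul_le_mul_of_nonneg_left is hκ.le
  have hκA := mul_le_mul_of_nonneg_left i2 hκ.le
  nlinarith [hκB, hκA, i3, ix, mul_nonneg hκ.le hc.le, hL4]

/-- **The route `LiebTwin` closes from the REAL FLIP-DEFINITE forms of its cruxes** (cycle-free deciding
theorem for the recommended restatement): K2 over real flip-definite ground states + K3″ over real
flip-definite ground states + `NoOnsiteODLRO` + the body of the proved support `RealFlipDefiniteSuffices`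
imply the summit, through `uniformDWaveFloor_of_realBondLocality` and
`IntrinsicLargeN.uniformLROGivesSummitMatrix_proof`. Scalapino, Phys. Rep. 250 (1995) 329, §2; Lieb, PRL 62
(1989) 1201. [folklore] -/
theorem hubbardSuperconductivity_of_realBondLocality :
    open Literature.MathematicalPhysics.QuantumLattice in open scoped MatrixOrder Matrix.Norms.L2Operator in
    (∃ U ∈ Set.Ioc (0 : ℝ) 4, ∃ δ ∈ Set.Icc (1 / 10 : ℝ) (3 / 10), ∃ c : ℝ, 0 < c ∧ ∃ L₀ : ℕ,
      ∀ (L : ℕ) [NeZero L], L₀ ≤ L → Even L → ∀ φ : Fock (Orb (FermionTorus 2 L)), star φ ⬝ᵥ φ = 1 →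
        IsGroundStateInSector (hubbardTorus 2 L 1 U) (2 * ⌊(1 - δ) * (L : ℝ) ^ 2 / 2⌋₊) 0 φ →
          (∀ s, star (φ s) = φ s) →
            ((liebW ⌊(1 - δ) * (L : ℝ) ^ 2 / 2⌋₊ φ)ᵀ = liebW ⌊(1 - δ) * (L : ℝ) ^ 2 / 2⌋₊ φ ∨
              (liebW ⌊(1 - δ) * (L : ℝ) ^ 2 / 2⌋₊ φ)ᵀ = -liebW ⌊(1 - δ) * (L : ℝ) ^ 2 / 2⌋₊ φ) →
            c * (L : ℝ) ^ 4 ≤ (expect ((pairField sWave L)ᴴ * pairField sWave L)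
              (liebVec ⌊(1 - δ) * (L : ℝ) ^ 2 / 2⌋₊ (CFC.abs (liebW ⌊(1 - δ) * (L : ℝ) ^ 2 / 2⌋₊ φ)))).re) →
    (∀ U ∈ Set.Ioc (0 : ℝ) 4, ∀ δ ∈ Set.Icc (1 / 10 : ℝ) (3 / 10), ∃ κ : ℝ, 0 < κ ∧ ∀ ε : ℝ, 0 < ε →
      ∃ L₀ : ℕ, ∀ (L : ℕ) [NeZero L], L₀ ≤ L → Even L → ∀ φ : Fock (Orb (FermionTorus 2 L)),
        star φ ⬝ᵥ φ = 1 →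
          IsGroundStateInSector (hubbardTorus 2 L 1 U) (2 * ⌊(1 - δ) * (L : ℝ) ^ 2 / 2⌋₊) 0 φ →
            (∀ s, star (φ s) = φ s) →
              ((liebW ⌊(1 - δ) * (L : ℝ) ^ 2 / 2⌋₊ φ)ᵀ = liebW ⌊(1 - δ) * (L : ℝ) ^ 2 / 2⌋₊ φ ∨
                (liebW ⌊(1 - δ) * (L : ℝ) ^ 2 / 2⌋₊ φ)ᵀ = -liebW ⌊(1 - δ) * (L : ℝ) ^ 2 / 2⌋₊ φ) →
              κ * ((expect ((pairField sWave L)ᴴ * pairField sWave L)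
                      (liebVec ⌊(1 - δ) * (L : ℝ) ^ 2 / 2⌋₊
                        (CFC.abs (liebW ⌊(1 - δ) * (L : ℝ) ^ 2 / 2⌋₊ φ)))).re -
                    (expect ((pairField sWave L)ᴴ * pairField sWave L) φ).re) -
                  ε * (L : ℝ) ^ 4 ≤
                (expect ((pairField dWaveFormFactor L)ᴴ * pairField dWaveFormFactor L) φ).re +
                  (expect ((pairField extendedSWave L)ᴴ * pairField extendedSWave L) φ).re) →
    Summit.HubbardSuperconductivity.HubbardSuperconductivity.Theses.EnslavedA1g.NoOnsiteODLRO →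
    (∀ (U a : ℝ) (L : ℕ) [NeZero L] (n : ℕ),
      (∀ φ : Fock (Orb (FermionTorus 2 L)), star φ ⬝ᵥ φ = 1 →
        IsGroundStateInSector (hubbardTorus 2 L 1 U) (2 * n) 0 φ → (∀ s, star (φ s) = φ s) →
          ((liebW n φ)ᵀ = liebW n φ ∨ (liebW n φ)ᵀ = -liebW n φ) →
            a ≤ (expect ((pairField dWaveFormFactor L)ᴴ * pairField dWaveFormFactor L) φ).re) →
        ∀ ψ : Fock (Orb (FermionTorus 2 L)), star ψ ⬝ᵥ ψ = 1 →
          IsGroundStateInSector (hubbardTorus 2 L 1 U) (2 * n) 0 ψ →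
            a ≤ (expect ((pairField dWaveFormFactor L)ᴴ * pairField dWaveFormFactor L) ψ).re) →
    _root_.HubbardSuperconductivity := by
  intro hK2 hK3 hNo hRF
  obtain ⟨U, hU, δ, hδ, floor⟩ := uniformDWaveFloor_of_realBondLocality hK2 hK3 hNo hRF
  have hmat := IntrinsicLargeN.uniformLROGivesSummitMatrix_proof U δ floor
  have hδ' : δ ∈ Set.Ioo (0 : ℝ) (1 / 2) := ⟨by linarith [hδ.1], by linarith [hδ.2]⟩
  unfold _root_.HubbardSuperconductivity Literature.Hubbard.DWaveSuperconductivityHubbard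
  exact ⟨U, hU.1, δ, hδ', fun N ψ hyp => hmat N ψ hyp⟩

end Summit.HubbardSuperconductivity.HubbardSuperconductivity.Theorems.LiebTwinBondLocality

end
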